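import Mathlib.Analysis.SpecialFunctions.Pow.Real
import Literature.MathematicalPhysics.QuantumFieldTheory.Balaban1983to89.BalabanAdmissibleClassParams
import HarnessLib

/-!
# THE SEED BUDGET: pen 11's closed form is `C₀·B^{3∕4} ≤ C₀·max 1 B`, so the seed row-mass is `wT ≤ C(rA, κs, κ)·max 1 (Bρ+Bρ′)·ωT^{1∕4}`
# and the NORMALISED seed is `x_T = wT∕(β_Tθ_T²) ≤ C·max (1∕b₀²) (2CB)·ωT^{1∕4}` — the one `div_le` line composition-v18's N1 budget eats (LEAD №15 (B))

Cell `ym3-torus` (YM ladder rung R3 = continuum `SU(2)` Yang–Mills on the three-torus — a RUNG, NOT d = 4, NOT infinite volume, NOT a mass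
gap, NOT Clay).  Width seat `ym3-torus-px5` (gen 18, «width 5»); `--supports stmt-QuantumFields-20520 --as helper`, count-neutral,
definition-free, default heartbeats; no registry, binder or `Lines/` edit (registered skeleton `Lines/semiclassical_s2beta.lean` v11.4, 0∕5,
★★OWNER RULING №36, untouched; `Lines/runpair_organ.lean` v17.2 untouched); no claim on the crux.

WHAT THIS IS.  LEAD-20520 w3 g24 WORD №15 (B) «GO (i)»: the `B^{3∕4}` READING of LEAD pen 11 ✓p798872 `…SeedLetterShape.seedLetter_eq`'s closed
form `800·√(32B)·√(800·√(6B))∕r²·√√σ` and the COROLLARY composition-v18's N1 budget (LEAD census of ideator g27 №4) actually consumes.  With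
✓p799301 `…SeedHTriple.seedTriple_of_seed_of_analytic_three` the H-seed row-mass of S3ᴴ∕O1ᵘ-H v2 is
`wT = 800·√(32(Bρ+Bρ))·√(800·√(6(Bρ+Bρ)))∕rA² · √√ωT · 3·(2(1+1∕(κs∕4−κ)))³ ∕ 4`; S1aᴴ's (β)-profile is `Bρ_T = CB·β_Tθ_T² = CB·p(g_T)²`
(print shape, [Balaban1985UV3] (7) p.257), and the frame normalises the seed as `x_T := wT ∕ (β_Tθ_T²)`, `β_T = L^T∕γ`.
* §1 (pure ℝ) `closedForm_eq_mul` — `800·√(32B)·√(800·√(6B)) = C₀·(√B·√√B)`, `C₀ := 800·√32·(√800·√√6)` — the `B^{3∕4}` reading (LEAD census (e)),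
  since `√B·√√B = B ^ (3∕4 : ℝ)` is ALREADY a tree theorem BY NAME: ✓`Literature.NumberTheory.Sieve.FriedlanderIwaniecPrimes.sqrt_mul_sqrt_sqrt` (one copy —
  not restated here; import that module where the `rpow` form is wanted); `sqrt_mul_sqrt_sqrt_le_max` — `√B·√√B ≤ max 1 B`; ★`closedForm_le_max` — `… ≤ C₀·max 1 B`.
* §2 ★★`seedRowMass_le_max` — the budget line in LEAD's shape: `wT ≤ (C₀∕rA²·S)·max 1 (Bρ+Bρ′)·√√ωT` for ANY nonnegative sum factor `S` (generic `d`
  and the `∕4`-editions are instances), and `seedRowMass_le_max_three` — the `_three ∕ 4` instance VERBATIM in ✓p799301's `wT` letters.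
* §3 (pure ℝ) `max_one_two_mul_div_le` — `max 1 (CB·p² + CB·p²) ∕ p² ≤ max (1∕b₀²) (2CB)` for `b₀² ≤ p²`, `0 < b₀`; ★★`normalisedSeed_le` — with
  `Bρ := CB·p²` (both towers): `wT ∕ p² ≤ (C₀∕rA²·S)·max (1∕b₀²) (2CB)·√√ωT` — `ωT` enters as `ωT^{1∕4}` and NOTHING ELSE depends on the height:
  `x_T → 0` from S2's `Tendsto σ atTop (𝓝 0)` alone (LEAD N1 «schedule arithmetic is rate-free»).
* §4 (frame letters) `b₀_le_pFun` ∕ `b₀_sq_le_pFun_sq` — `b₀ ≤ p(g) = b₀(1 + log g⁻¹)^{p₀}` for `0 < g ≤ 1`, `0 ≤ b₀`, `0 ≤ p₀`;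
  ★`b₀_sq_le_beta_mul_θBal_sq` — `b₀² ≤ (L^j∕γ)·θBal_j² (= p(g_j)²)` for `0 < γ ≤ 1` (lit ✓`BalabanUVClass.AdmissibleClassParams.pFun_sq_eq`); and
  ★★`normalisedSeed_le_frame` — §3 in the frame's letters: `wT(Bρ := CB·((L^T∕γ)·θBal_T²)) ∕ ((L^T∕γ)·θBal_T²) ≤ (C₀∕rA²·S)·max (1∕b₀²) (2CB)·√√ωT`.
WHAT THIS IS NOT: arithmetic; nothing of Bałaban's; the seed clause, (β) and S1aᴴ's profile are HYPOTHESES elsewhere; O1ᵘ-H v2∕S3ᴴ∕composition-v18∕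
crux 20520 `FluctuationComparisonRegPrIntL`∕`YM3TorusSU2` NOT proved.  R3 = SU(2) YM₃ on T³ — NOT d = 4, NOT infinite volume, NOT a mass gap, NOT
Clay; the Yang–Mills mass gap is NOT proved.
[cite: Balaban1985UV3, (7) p.257 and p.263]
-/

set_option autoImplicit false

noncomputable section

namespace Summit.QuantumFields.YangMills.Theorems.OrganTangentSeedBudget

open Literature.MathematicalPhysics.QuantumFieldTheory.Balaban1983to89
open T3UnitScaleTilt (θBal)

/-! ## §1 The closed form is `C₀·(√B·√√B) = C₀·B^{3∕4} ≤ C₀·max 1 B` (`√B·√√B = B^{3∕4}`: ✓`FriedlanderIwaniecPrimes.sqrt_mul_sqrt_sqrt`) -/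

/-- FACTORISATION: `800·√(32B)·√(800·√(6B)) = 800·√32·(√800·√√6)·(√B·√√B)` (every real `B`; `Real.sqrt_mul` needs only `0 ≤ 32, 6, 800`). [folklore] -/
theorem closedForm_eq_mul (B : ℝ) :
    800 * Real.sqrt (32 * B) * Real.sqrt (800 * Real.sqrt (6 * B)) =
      800 * Real.sqrt 32 * (Real.sqrt 800 * Real.sqrt (Real.sqrt 6)) * (Real.sqrt B * Real.sqrt (Real.sqrt B)) := by
  rw [Real.sqrt_mul (by norm_num : (0:ℝ) ≤ 32), Real.sqrt_mul (by norm_num : (0:ℝ) ≤ 6),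
    Real.sqrt_mul (by norm_num : (0:ℝ) ≤ 800), Real.sqrt_mul (Real.sqrt_nonneg 6)]
  ring

/-- `√B·√√B ≤ max 1 B` for `0 ≤ B` (`B ≤ 1`: both roots `≤ 1`; `1 ≤ B`: `√√B ≤ √B` and `√B·√B = B`). [folklore] -/
theorem sqrt_mul_sqrt_sqrt_le_max {B : ℝ} (hB : 0 ≤ B) :
    Real.sqrt B * Real.sqrt (Real.sqrt B) ≤ max 1 B := by
  rcases le_total B 1 with h1 | h1
  · have hs : Real.sqrt B ≤ 1 := Real.sqrt_le_one.mpr h1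
    have hss : Real.sqrt (Real.sqrt B) ≤ 1 := Real.sqrt_le_one.mpr hs
    calc Real.sqrt B * Real.sqrt (Real.sqrt B) ≤ 1 * 1 :=
          mul_le_mul hs hss (Real.sqrt_nonneg _) zero_le_one
      _ = 1 := one_mul _
      _ ≤ max 1 B := le_max_left _ _
  · have hs : Real.sqrt B ≤ B := by
      have h := Real.sqrt_le_sqrt (le_trans (le_of_eq (one_mul B).symm) (mul_le_mul_of_nonneg_right h1 hB))
      rwa [Real.sqrt_mul_self hB] at h
    have hss : Real.sqrt (Real.sqrt B) ≤ Real.sqrt B := Real.sqrt_le_sqrt hs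
    calc Real.sqrt B * Real.sqrt (Real.sqrt B) ≤ Real.sqrt B * Real.sqrt B :=
          mul_le_mul_of_nonneg_left hss (Real.sqrt_nonneg _)
      _ = B := Real.mul_self_sqrt hB
      _ ≤ max 1 B := le_max_right _ _

/-- ★ **THE CLOSED FORM IS AT MOST `C₀·max 1 B`**: `800·√(32B)·√(800·√(6B)) ≤ 800·√32·(√800·√√6)·max 1 B` for `0 ≤ B`. [folklore] -/
theorem closedForm_le_max {B : ℝ} (hB : 0 ≤ B) :
    800 * Real.sqrt (32 * B) * Real.sqrt (800 * Real.sqrt (6 * B)) ≤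
      800 * Real.sqrt 32 * (Real.sqrt 800 * Real.sqrt (Real.sqrt 6)) * max 1 B := by
  rw [closedForm_eq_mul B]
  exact mul_le_mul_of_nonneg_left (sqrt_mul_sqrt_sqrt_le_max hB) (by positivity)

/-! ## §2 ★★ The seed row-mass budget: `wT ≤ C(rA, κs, κ)·max 1 (Bρ+Bρ′)·ωT^{1∕4}` -/

/-- ★★ **THE BUDGET LINE** (LEAD №15 (B)): for ANY nonnegative sum factor `S` (the torus row-sum constant `d·(2(1+1∕(κs∕4−κ)))^d`, its `∕4`,
…) and profile `0 ≤ B` (`:= Bρ + Bρ′`): `800·√(32B)·√(800·√(6B))∕r²·√√ω·S ≤ (800·√32·(√800·√√6)∕r²·S)·max 1 B·√√ω`. [folklore] -/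
theorem seedRowMass_le_max {B r ω S : ℝ} (hB : 0 ≤ B) (hS : 0 ≤ S) :
    800 * Real.sqrt (32 * B) * Real.sqrt (800 * Real.sqrt (6 * B)) / r ^ 2 * Real.sqrt (Real.sqrt ω) * S ≤
      800 * Real.sqrt 32 * (Real.sqrt 800 * Real.sqrt (Real.sqrt 6)) / r ^ 2 * S * max 1 B * Real.sqrt (Real.sqrt ω) := by
  have h := closedForm_le_max hB
  have hr : 0 ≤ (r ^ 2)⁻¹ := inv_nonneg.mpr (sq_nonneg r)
  have hω : 0 ≤ Real.sqrt (Real.sqrt ω) := Real.sqrt_nonneg _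
  calc 800 * Real.sqrt (32 * B) * Real.sqrt (800 * Real.sqrt (6 * B)) / r ^ 2 * Real.sqrt (Real.sqrt ω) * S
      = 800 * Real.sqrt (32 * B) * Real.sqrt (800 * Real.sqrt (6 * B)) * ((r ^ 2)⁻¹ * Real.sqrt (Real.sqrt ω) * S) := by ring
    _ ≤ 800 * Real.sqrt 32 * (Real.sqrt 800 * Real.sqrt (Real.sqrt 6)) * max 1 B * ((r ^ 2)⁻¹ * Real.sqrt (Real.sqrt ω) * S) :=
        mul_le_mul_of_nonneg_right h (by positivity)
    _ = _ := by ring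

/-- The same with a trailing `∕ 4` (the once-converted seed of spec v1.5 (ii) ∕ ✓p799301). [folklore] -/
theorem seedRowMass_div_four_le_max {B r ω S : ℝ} (hB : 0 ≤ B) (hS : 0 ≤ S) :
    800 * Real.sqrt (32 * B) * Real.sqrt (800 * Real.sqrt (6 * B)) / r ^ 2 * Real.sqrt (Real.sqrt ω) * S / 4 ≤
      800 * Real.sqrt 32 * (Real.sqrt 800 * Real.sqrt (Real.sqrt 6)) / r ^ 2 * S / 4 * max 1 B * Real.sqrt (Real.sqrt ω) := by
  have h := seedRowMass_le_max (r := r) (ω := ω) hB hS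
  have : 800 * Real.sqrt 32 * (Real.sqrt 800 * Real.sqrt (Real.sqrt 6)) / r ^ 2 * S / 4 * max 1 B * Real.sqrt (Real.sqrt ω) =
      800 * Real.sqrt 32 * (Real.sqrt 800 * Real.sqrt (Real.sqrt 6)) / r ^ 2 * S * max 1 B * Real.sqrt (Real.sqrt ω) / 4 := by ring
  rw [this]
  exact div_le_div_of_nonneg_right h (by norm_num)

/-- ★★ **THE BUDGET LINE IN ✓p799301's LETTERS** (`seedTriple_of_seed_of_analytic_three`'s `wT`, d = 3, profile `Bρ + Bρ`):
`wT ≤ C(rA, κs, κ)·max 1 (Bρ+Bρ)·√√ωT` with `C(rA, κs, κ) := 800·√32·(√800·√√6)∕rA²·(3·(2(1+1∕(κs∕4−κ)))³)∕4`. [cite: Balaban1985UV3, p.263] -/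
theorem seedRowMass_le_max_three {rA Bρ ωT κs κ : ℝ} (hBρ : 0 ≤ Bρ) (hκ : κ < κs / 4) :
    800 * Real.sqrt (32 * (Bρ + Bρ)) * Real.sqrt (800 * Real.sqrt (6 * (Bρ + Bρ))) / rA ^ 2 * Real.sqrt (Real.sqrt ωT) *
          (3 * (2 * (1 + 1 / (κs / 4 - κ))) ^ 3) / 4 ≤
      800 * Real.sqrt 32 * (Real.sqrt 800 * Real.sqrt (Real.sqrt 6)) / rA ^ 2 * (3 * (2 * (1 + 1 / (κs / 4 - κ))) ^ 3) / 4 *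
        max 1 (Bρ + Bρ) * Real.sqrt (Real.sqrt ωT) := by
  have ha : 0 < κs / 4 - κ := sub_pos.mpr hκ
  exact seedRowMass_div_four_le_max (by positivity) (by positivity)

/-! ## §3 The normalised seed `x_T = wT∕p(g_T)²` with `Bρ = CB·p(g_T)²` -/

/-- `max 1 (CB·p² + CB·p²) ∕ p² ≤ max (1∕b₀²) (2CB)` for `0 < b₀`, `b₀² ≤ p²`. [folklore] -/
theorem max_one_two_mul_div_le {b₀ p2 CB : ℝ} (hb₀ : 0 < b₀) (hp : b₀ ^ 2 ≤ p2) :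
    max 1 (CB * p2 + CB * p2) / p2 ≤ max (1 / b₀ ^ 2) (2 * CB) := by
  have hb2 : 0 < b₀ ^ 2 := pow_pos hb₀ 2
  have hp2 : 0 < p2 := lt_of_lt_of_le hb2 hp
  rw [div_le_iff₀ hp2]
  refine max_le ?_ ?_
  · calc (1 : ℝ) = 1 / b₀ ^ 2 * b₀ ^ 2 := by field_simp
      _ ≤ 1 / b₀ ^ 2 * p2 := mul_le_mul_of_nonneg_left hp (by positivity)
      _ ≤ max (1 / b₀ ^ 2) (2 * CB) * p2 := mul_le_mul_of_nonneg_right (le_max_left _ _) hp2.le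
  · calc CB * p2 + CB * p2 = 2 * CB * p2 := by ring
      _ ≤ max (1 / b₀ ^ 2) (2 * CB) * p2 := mul_le_mul_of_nonneg_right (le_max_right _ _) hp2.le

/-- ★★ **THE NORMALISED SEED** (LEAD №15 (B)): with the (β)-profile `Bρ := CB·p²` on both towers (`p² := β_Tθ_T² = p(g_T)² ≥ b₀²`) and ANY
nonnegative sum factor `S`: `wT ∕ p² ≤ (800·√32·(√800·√√6)∕r²·S)·max (1∕b₀²) (2CB)·√√ω` — `ω` enters as `ω^{1∕4}`, nothing else depends on
the height. [cite: Balaban1985UV3, (7) p.257 and p.263] -/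
theorem normalisedSeed_le {b₀ p2 CB r ω S : ℝ} (hb₀ : 0 < b₀) (hp : b₀ ^ 2 ≤ p2) (hCB : 0 ≤ CB) (hS : 0 ≤ S) :
    800 * Real.sqrt (32 * (CB * p2 + CB * p2)) * Real.sqrt (800 * Real.sqrt (6 * (CB * p2 + CB * p2))) / r ^ 2 *
          Real.sqrt (Real.sqrt ω) * S / p2 ≤
      800 * Real.sqrt 32 * (Real.sqrt 800 * Real.sqrt (Real.sqrt 6)) / r ^ 2 * S * max (1 / b₀ ^ 2) (2 * CB) * Real.sqrt (Real.sqrt ω) := by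
  have hp2 : 0 < p2 := lt_of_lt_of_le (pow_pos hb₀ 2) hp
  have hB : 0 ≤ CB * p2 + CB * p2 := by positivity
  have h1 := seedRowMass_le_max (r := r) (ω := ω) hB hS
  have h2 := max_one_two_mul_div_le (CB := CB) hb₀ hp
  have hC : 0 ≤ 800 * Real.sqrt 32 * (Real.sqrt 800 * Real.sqrt (Real.sqrt 6)) / r ^ 2 * S := by positivity
  have hω : 0 ≤ Real.sqrt (Real.sqrt ω) := Real.sqrt_nonneg _
  calc 800 * Real.sqrt (32 * (CB * p2 + CB * p2)) * Real.sqrt (800 * Real.sqrt (6 * (CB * p2 + CB * p2))) / r ^ 2 *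
          Real.sqrt (Real.sqrt ω) * S / p2
      ≤ 800 * Real.sqrt 32 * (Real.sqrt 800 * Real.sqrt (Real.sqrt 6)) / r ^ 2 * S * max 1 (CB * p2 + CB * p2) *
          Real.sqrt (Real.sqrt ω) / p2 := div_le_div_of_nonneg_right h1 hp2.le
    _ = 800 * Real.sqrt 32 * (Real.sqrt 800 * Real.sqrt (Real.sqrt 6)) / r ^ 2 * S *
          (max 1 (CB * p2 + CB * p2) / p2) * Real.sqrt (Real.sqrt ω) := by ring
    _ ≤ 800 * Real.sqrt 32 * (Real.sqrt 800 * Real.sqrt (Real.sqrt 6)) / r ^ 2 * S * max (1 / b₀ ^ 2) (2 * CB) *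
          Real.sqrt (Real.sqrt ω) :=
        mul_le_mul_of_nonneg_right (mul_le_mul_of_nonneg_left h2 hC) hω

/-- The same with the trailing `∕ 4` of ✓p799301's `wT`. [folklore] -/
theorem normalisedSeed_div_four_le {b₀ p2 CB r ω S : ℝ} (hb₀ : 0 < b₀) (hp : b₀ ^ 2 ≤ p2) (hCB : 0 ≤ CB) (hS : 0 ≤ S) :
    800 * Real.sqrt (32 * (CB * p2 + CB * p2)) * Real.sqrt (800 * Real.sqrt (6 * (CB * p2 + CB * p2))) / r ^ 2 *
          Real.sqrt (Real.sqrt ω) * S / 4 / p2 ≤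
      800 * Real.sqrt 32 * (Real.sqrt 800 * Real.sqrt (Real.sqrt 6)) / r ^ 2 * S / 4 * max (1 / b₀ ^ 2) (2 * CB) *
        Real.sqrt (Real.sqrt ω) := by
  have h := normalisedSeed_le (r := r) (ω := ω) hb₀ hp hCB hS
  have hp2 : 0 < p2 := lt_of_lt_of_le (pow_pos hb₀ 2) hp
  have e1 : 800 * Real.sqrt (32 * (CB * p2 + CB * p2)) * Real.sqrt (800 * Real.sqrt (6 * (CB * p2 + CB * p2))) / r ^ 2 *
          Real.sqrt (Real.sqrt ω) * S / 4 / p2 =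
      (800 * Real.sqrt (32 * (CB * p2 + CB * p2)) * Real.sqrt (800 * Real.sqrt (6 * (CB * p2 + CB * p2))) / r ^ 2 *
          Real.sqrt (Real.sqrt ω) * S / p2) / 4 := by ring
  have e2 : 800 * Real.sqrt 32 * (Real.sqrt 800 * Real.sqrt (Real.sqrt 6)) / r ^ 2 * S / 4 * max (1 / b₀ ^ 2) (2 * CB) *
        Real.sqrt (Real.sqrt ω) =
      (800 * Real.sqrt 32 * (Real.sqrt 800 * Real.sqrt (Real.sqrt 6)) / r ^ 2 * S * max (1 / b₀ ^ 2) (2 * CB) *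
        Real.sqrt (Real.sqrt ω)) / 4 := by ring
  rw [e1, e2]
  exact div_le_div_of_nonneg_right h (by norm_num)

/-! ## §4 The frame's letters: `b₀² ≤ β_jθ_j² = p(g_j)²` -/

/-- `b₀ ≤ p(g) = b₀·(1 + log g⁻¹)^{p₀}` for `0 < g ≤ 1`, `0 ≤ b₀`, `0 ≤ p₀` (`log g⁻¹ ≥ 0`, `Real.one_le_rpow`). [cite: Balaban1985UV3, (7) p.257] -/
theorem b₀_le_pFun {b₀ p₀ g : ℝ} (hb : 0 ≤ b₀) (hp₀ : 0 ≤ p₀) (hg : 0 < g) (hg1 : g ≤ 1) : b₀ ≤ B10.pFun b₀ p₀ g := by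
  have hx : 0 ≤ Real.log g⁻¹ := B10.log_inv_nonneg_of_le_one hg hg1
  have h1 : (1 : ℝ) ≤ (1 + Real.log g⁻¹) ^ p₀ := Real.one_le_rpow (by linarith) hp₀
  calc b₀ = b₀ * 1 := (mul_one _).symm
    _ ≤ b₀ * (1 + Real.log g⁻¹) ^ p₀ := mul_le_mul_of_nonneg_left h1 hb
    _ = B10.pFun b₀ p₀ g := rfl

/-- `b₀² ≤ p(g)²` for `0 < g ≤ 1`, `0 ≤ b₀`, `0 ≤ p₀`. [cite: Balaban1985UV3, (7) p.257] -/
theorem b₀_sq_le_pFun_sq {b₀ p₀ g : ℝ} (hb : 0 ≤ b₀) (hp₀ : 0 ≤ p₀) (hg : 0 < g) (hg1 : g ≤ 1) :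
    b₀ ^ 2 ≤ B10.pFun b₀ p₀ g ^ 2 :=
  pow_le_pow_left₀ hb (b₀_le_pFun hb hp₀ hg hg1) 2

/-- ★ **IN THE FRAME's LETTERS**: `b₀² ≤ (L^j∕γ)·θBal_j²` (`= p(g_j)²`, lit ✓`BalabanUVClass.AdmissibleClassParams.pFun_sq_eq`) for a family `F`, `0 < γ ≤ 1`,
`0 ≤ b₀`, `0 ≤ p₀` (the coupling `g_j = √(γ·L^{−j}) ∈ (0, 1]`). [cite: Balaban1985UV3, (7) p.257] -/
theorem b₀_sq_le_beta_mul_θBal_sq (F : T3ContinuumYM3Torus.T3Family) {γ b₀ p₀ : ℝ} (hγ : 0 < γ) (hγ1 : γ ≤ 1) (hb : 0 ≤ b₀)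
    (hp₀ : 0 ≤ p₀) (j : ℕ) :
    b₀ ^ 2 ≤ (F.L : ℝ) ^ j / γ * θBal F.L γ b₀ p₀ j ^ 2 := by
  have hL1 : (1 : ℝ) ≤ F.L := by exact_mod_cast F.hL.2.le
  have hL : (0 : ℝ) < F.L := lt_of_lt_of_le one_pos hL1
  have hx : 0 < γ * ((F.L : ℝ)⁻¹) ^ j := mul_pos hγ (pow_pos (inv_pos.mpr hL) j)
  have hx1 : γ * ((F.L : ℝ)⁻¹) ^ j ≤ 1 := by
    have hpow : ((F.L : ℝ)⁻¹) ^ j ≤ 1 := pow_le_one₀ (inv_nonneg.mpr hL.le) (inv_le_one_of_one_le₀ hL1)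
    calc γ * ((F.L : ℝ)⁻¹) ^ j ≤ 1 * 1 := mul_le_mul hγ1 hpow (pow_nonneg (inv_nonneg.mpr hL.le) j) zero_le_one
      _ = 1 := one_mul _
  have hg : 0 < Real.sqrt (γ * ((F.L : ℝ)⁻¹) ^ j) := Real.sqrt_pos.mpr hx
  have hg1 : Real.sqrt (γ * ((F.L : ℝ)⁻¹) ^ j) ≤ 1 := Real.sqrt_le_one.mpr hx1
  rw [← BalabanUVClass.AdmissibleClassParams.pFun_sq_eq F hγ b₀ p₀ j]
  exact b₀_sq_le_pFun_sq hb hp₀ hg hg1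

/-- ★★ **THE NORMALISED SEED IN THE FRAME's LETTERS**: with `p² := (L^T∕γ)·θBal_T²`, `Bρ := CB·p²` on both towers, `0 < γ ≤ 1`, `0 < b₀`, `0 ≤ p₀`,
`0 ≤ CB`, any nonnegative `S`: `wT ∕ p² ≤ (800·√32·(√800·√√6)∕r²·S)·max (1∕b₀²) (2CB)·√√ω` — the seed is `O(ωT^{1∕4})` UNIFORMLY IN THE HEIGHT
`T` (LEAD N1: the schedule stays rate-free; `x_T → 0` from `Tendsto σ atTop (𝓝 0)` alone). [cite: Balaban1985UV3, (7) p.257 and p.263] -/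
theorem normalisedSeed_le_frame (F : T3ContinuumYM3Torus.T3Family) {γ b₀ p₀ CB r ω S : ℝ} (hγ : 0 < γ) (hγ1 : γ ≤ 1) (hb₀ : 0 < b₀)
    (hp₀ : 0 ≤ p₀) (hCB : 0 ≤ CB) (hS : 0 ≤ S) (T : ℕ) :
    800 * Real.sqrt (32 * (CB * ((F.L : ℝ) ^ T / γ * θBal F.L γ b₀ p₀ T ^ 2) + CB * ((F.L : ℝ) ^ T / γ * θBal F.L γ b₀ p₀ T ^ 2))) *
          Real.sqrt (800 * Real.sqrt (6 * (CB * ((F.L : ℝ) ^ T / γ * θBal F.L γ b₀ p₀ T ^ 2) +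
            CB * ((F.L : ℝ) ^ T / γ * θBal F.L γ b₀ p₀ T ^ 2)))) / r ^ 2 * Real.sqrt (Real.sqrt ω) * S /
          ((F.L : ℝ) ^ T / γ * θBal F.L γ b₀ p₀ T ^ 2) ≤
      800 * Real.sqrt 32 * (Real.sqrt 800 * Real.sqrt (Real.sqrt 6)) / r ^ 2 * S * max (1 / b₀ ^ 2) (2 * CB) * Real.sqrt (Real.sqrt ω) :=
  normalisedSeed_le hb₀ (b₀_sq_le_beta_mul_θBal_sq F hγ hγ1 hb₀.le hp₀ T) hCB hS

end Summit.QuantumFields.YangMills.Theorems.OrganTangentSeedBudget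

end
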